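import Literature.NumberTheory.EllipticCurves.PadicSigmaUniquenessProofs
import Literature.NumberTheory.EllipticCurves.FormalGroupHasseInvariantProofs
import Literature.NumberTheory.EllipticCurves.PointCountHasseInvariantProofs
import Literature.NumberTheory.EllipticCurves.LFunctionPrimeCoeff
import HarnessLib

/-!
# The Mazur–Tate sigma function: the uniqueness half of MST 2006 Thm. 1.3 at a good ORDINARY prime,
# unconditionally; the named fact reduced to bare existence (proofs only)

Trunk T-NT-EC (Literature/NumberTheory/EllipticCurves). Fourth support file of the named fact
`WeierstrassCurve.mazur_tate_sigma_existsUnique` (`PadicSigma.lean`; Mazur–Stein–Tate 2006,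
Thm. 1.3 = Mazur–Tate 1991, Thm. 3.1). `PadicSigmaUniquenessProofs.lean` proved uniqueness of
the Mazur–Tate pair `(σ, c)` GIVEN that the coefficients `c_{p^k-1}` of the invariant differential
of `W ⊗ ℚ_p` are `p`-adic units (`unbounded_formalLog_of_norm_coeff_formalOmega_eq_one`,
`mazur_tate_sigma_existsUnique_of`). This file supplies that input from the hypotheses of the
named fact — `W/ℚ` globally minimal, `p ≥ 5` of good reduction, `p ∤ a_p` — by assembling

* `FormalGroupHasseInvariantProofs.lean`: `c_{p^k-1} ≡ A^{1+p+⋯+p^{k-1}} (mod p)` for the integral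
  model, `A` = Hasse's polynomial in the `aᵢ` (Deuring; Blakestad–Grant 2023 Prop. 3(b), Lemma 4);
* `PointCountHasseInvariantProofs.lean`: `a_p ≡ A (mod p)` (Silverman AEC V.4.1(a));
* the plumbing (`not_dvd_minimalDiscriminantInt_of_good`, private; the tree has it as
  `not_dvd_minimalDiscriminantInt_of_hasGoodReductionAtPrime` behind heavy imports): good reduction at `p`
  of a globally minimal `W` means `p ∤ Δ_min(W)` (AEC VII.1.3(b), VII.5.1(a): `W ⊗ ℚ_p` is itself a
  minimal equation, so its discriminant is a `p`-adic unit), so that the reduction of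
  `integralModelInt W` modulo `p` IS an elliptic curve over `𝔽_p` whose point count defines `a_p`.

Results:

* `norm_coeff_formalOmega_eq_one_of_good_ordinary` — `‖c_{p^{k+1}-1}(W ⊗ ℚ_p)‖ = 1`;
* `unbounded_formalLog_of_good_ordinary` — the coefficients of `log_{W ⊗ ℚ_p}` are `p`-adically
  unbounded (`‖coeff (p^{k+1}) log‖ = p^{k+1}`);
* `IsMazurTateSigmaPair.unique_of_good_ordinary` — **the uniqueness half of MST 2006 Thm. 1.3,
  proved**: at a prime `p ≥ 5` of good ordinary reduction of a globally minimal `W/ℚ`, two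
  Mazur–Tate sigma pairs of `W ⊗ ℚ_p` coincide;
* `mazur_tate_sigma_existsUnique_of_exists` — the named fact follows from the EXISTENCE of a pair
  alone (Mazur–Tate 1991 §2 / Blakestad–Grant 2023 Thm. 1, the deep half, NOT proved here).

## Sources

* B. Mazur, W. Stein, J. Tate, Doc. Math. Extra Vol. Coates (2006), Thm. 1.3 ("exactly one"),
  Remark 1.4. [MazurSteinTate2006]
* B. Mazur, J. Tate, *The `p`-adic sigma function*, Duke Math. J. 62 (1991), Thm. 3.1.
* J. H. Silverman, *AEC* 2nd ed. (2009), V.4.1(a); VII.1.3(b), VII.5.1(a). [SilvermanAEC2009]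
* C. Blakestad, D. Grant, J. Number Theory 249 (2023), Prop. 3(b), Lemma 4. [BlakestadGrant2023]

No definitions, no named facts.
-/

noncomputable section

open PowerSeries Literature.NumberTheory.EllipticCurves

namespace WeierstrassCurve

section GoodReduction

open IsDedekindDomain NumberField Rat.HeightOneSpectrum

/-- **Good reduction at `p` of a globally minimal equation means `p ∤ Δ_min`.** `W ⊗ ℚ_p` is a
minimal equation at `p` (global minimality at the place `v` over `p`, transported along
`ℚ_v ≃ ℚ_p`), so it has good reduction together with Mathlib's chosen minimal model
(AEC VII.1.3(b)), i.e. `v_p(Δ_W) = 0`. (A local copy of the tree's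
`WeierstrassCurve.not_dvd_minimalDiscriminantInt_of_hasGoodReductionAtPrime`, which lives in
`PAdicGrossZagierConstantTermProofs.lean` behind the modularity/Gross–Zagier import closure; kept
private here to keep this file's imports light.) [Silverman AEC VII.1.3(b), VII.5.1(a)]
[cite: SilvermanAEC2009, VII.5 Prop. 5.1(a) (PDF p. 174) and VII.1 Prop. 1.3(b) (PDF p. 165)] -/
private theorem not_dvd_minimalDiscriminantInt_of_good (W : WeierstrassCurve ℚ)
    [W.IsGloballyMinimal] (p : ℕ) [Fact p.Prime] (h : W.HasGoodReductionAtPrime p) :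
    ¬ (p : ℤ) ∣ minimalDiscriminantInt W := by
  obtain ⟨v, hv⟩ : ∃ v : HeightOneSpectrum (𝓞 ℚ), (primesEquiv v : ℕ) = p :=
    ⟨primesEquiv.symm ⟨p, Fact.out⟩, by rw [Equiv.apply_symm_apply]⟩
  subst hv
  have he := padicEquiv_mem_range_iff_ringOfIntegers v
  -- `e` maps `W / ℚ_v` to `W / ℚ_[p]`
  have hW : (W.baseChange (v.adicCompletion ℚ)).map
      ((adicCompletion.padicEquiv v).toAlgEquiv.toRingEquiv :
        v.adicCompletion ℚ →+* ℚ_[(primesEquiv v : ℕ)]) = W.baseChange ℚ_[(primesEquiv v : ℕ)] := by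
    simp only [baseChange, map_map]
    exact congrArg W.map (Subsingleton.elim _ _)
  -- `W ⊗ ℚ_p` is a minimal equation
  haveI hmin : (W.baseChange ℚ_[(primesEquiv v : ℕ)]).IsMinimal ℤ_[(primesEquiv v : ℕ)] := by
    rw [← hW]
    exact (isMinimal_map_iff _ he _).mpr (IsGloballyMinimal.isMinimal v)
  -- so it has good reduction together with the chosen minimal model
  obtain ⟨D, hD⟩ : ∃ D : VariableChange ℚ_[(primesEquiv v : ℕ)],
      (W.baseChange ℚ_[(primesEquiv v : ℕ)]).minimal ℤ_[(primesEquiv v : ℕ)] =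
        D • W.baseChange ℚ_[(primesEquiv v : ℕ)] := ⟨_, rfl⟩
  have hgood : (W.baseChange ℚ_[(primesEquiv v : ℕ)]).HasGoodReduction ℤ_[(primesEquiv v : ℕ)] :=
    (hasGoodReduction_iff_of_isMinimal_of_eq_smul ℤ_[(primesEquiv v : ℕ)] hD).mp h
  -- read off `v(Δ) = 1` on the integral model `integralModelInt W ⊗ ℤ_p`
  set Mp : WeierstrassCurve ℤ_[(primesEquiv v : ℕ)] :=
    (integralModelInt W).map (Int.castRingHom ℤ_[(primesEquiv v : ℕ)]) with hMp
  have hWM : W.baseChange ℚ_[(primesEquiv v : ℕ)] = Mp.baseChange ℚ_[(primesEquiv v : ℕ)] := by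
    conv_lhs => rw [← map_integralModelInt W]
    rw [baseChange, baseChange, map_map, hMp, map_map]
    congr 1
  have hΔ := hgood.goodReduction
  rw [hWM, baseChange, map_Δ, IsDedekindDomain.HeightOneSpectrum.valuation_eq_one_iff_notMem] at hΔ
  change Mp.Δ ∉ IsLocalRing.maximalIdeal ℤ_[(primesEquiv v : ℕ)] at hΔ
  rw [hMp, map_Δ, IsLocalRing.mem_maximalIdeal, PadicInt.mem_nonunits, eq_intCast,
    PadicInt.norm_int_lt_one_iff_dvd] at hΔ
  exact hΔ

end GoodReduction

section Ordinary

variable (W : WeierstrassCurve ℚ) [W.IsGloballyMinimal] (p : ℕ) [Fact p.Prime]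

/-- **Ordinary means nonzero Hasse invariant**: at an odd prime `p` of good reduction with `p ∤ a_p`
(`a_p = p + 1 - #Ẽ(𝔽_p)`, the tree's `frobeniusTrace`), the Hasse polynomial of the reduction
`Ẽ = integralModelInt W mod p` does not vanish — because `a_p ≡ A_p (mod p)` (AEC V.4.1(a)).
[Silverman AEC V.4.1(a)] [cite: SilvermanAEC2009, V.4.1] -/
theorem hasseCoeff_reduction_ne_zero (hp2 : p ≠ 2) (hgood : W.HasGoodReductionAtPrime p)
    (hord : ¬ (p : ℤ) ∣ W.frobeniusTrace p) :
    ((integralModelInt W).map (Int.castRingHom (ZMod p))).hasseCoeff p ≠ 0 := by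
  set E : WeierstrassCurve (ZMod p) := (integralModelInt W).map (Int.castRingHom (ZMod p)) with hE
  have hΔ := not_dvd_minimalDiscriminantInt_of_good W p hgood
  haveI : E.IsElliptic := by
    rw [isElliptic_iff, hE, map_Δ, isUnit_iff_ne_zero, eq_intCast, Ne,
      ZMod.intCast_zmod_eq_zero_iff_dvd]
    exact hΔ
  have h2 : ringChar (ZMod p) ≠ 2 := by rwa [ZMod.ringChar_zmod_n]
  have key := E.cast_card_add_one_sub_natCard_point h2
  rw [ZMod.card] at key
  intro hA
  apply hord
  rw [← ZMod.intCast_zmod_eq_zero_iff_dvd, frobeniusTrace, reductionPointCount]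
  rw [hasseCoeff] at hA
  rw [← hA]
  exact key

/-- **`‖c_{p^{k+1}-1}(W ⊗ ℚ_p)‖_p = 1` at a prime `p ≥ 3` of good ordinary reduction** of a globally
minimal `W/ℚ` (`ω = Σ cₙ zⁿ dz` the invariant differential of the equation): the integral model has
`c_{p^k-1} ≡ A^{1+p+⋯+p^{k-1}} ≢ 0 (mod p)`. [Blakestad–Grant 2023, Prop. 3(b) and Lemma 4;
Silverman AEC V.4.1(a)] [cite: BlakestadGrant2023, Lemma 4] -/
theorem norm_coeff_formalOmega_eq_one_of_good_ordinary (hp2 : p ≠ 2)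
    (hgood : W.HasGoodReductionAtPrime p) (hord : ¬ (p : ℤ) ∣ W.frobeniusTrace p) (k : ℕ) :
    ‖coeff (p ^ (k + 1) - 1) (W.baseChange ℚ_[p]).formalOmega‖ = 1 := by
  have hA := hasseCoeff_reduction_ne_zero W p hp2 hgood hord
  have hndvd := not_dvd_coeff_formalInvDiff_of_hasseCoeff_ne_zero (integralModelInt W) p hp2 hA (k + 1)
  have hW : W.baseChange ℚ_[p] = (integralModelInt W).map (Int.castRingHom ℚ_[p]) := by
    conv_lhs => rw [← map_integralModelInt W]
    rw [baseChange, map_map]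
    exact congrArg (integralModelInt W).map (RingHom.ext_int _ _)
  rw [← formalInvDiff_eq_formalOmega, hW, ← map_formalInvDiff, coeff_map, eq_intCast]
  exact le_antisymm (Padic.norm_int_le_one _) (not_lt.mp (mt Padic.norm_intCast_lt_one_iff.mp hndvd))

/-- **The formal logarithm of `W ⊗ ℚ_p` has `p`-adically unbounded coefficients at a prime `p ≥ 5`
of good ordinary reduction** (`coeff (p^{k+1}) log = c_{p^{k+1}-1}/p^{k+1}` has norm `p^{k+1}`).
This is exactly hypothesis (a) of `mazur_tate_sigma_existsUnique_of`
(`PadicSigmaUniquenessProofs.lean`). [Silverman AEC IV.5.5 (`log = Σ cₙtⁿ/n`), V.4.1(a);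
Blakestad–Grant 2023, Lemma 4] [cite: BlakestadGrant2023, Lemma 4] -/
theorem unbounded_formalLog_of_good_ordinary (hp : 5 ≤ p) (hgood : W.HasGoodReductionAtPrime p)
    (hord : ¬ (p : ℤ) ∣ W.frobeniusTrace p) :
    ∀ N : ℕ, ∃ m, (p : ℝ) ^ N < ‖coeff m (W.baseChange ℚ_[p]).formalLog‖ :=
  (W.baseChange ℚ_[p]).unbounded_formalLog_of_norm_coeff_formalOmega_eq_one
    (fun k => norm_coeff_formalOmega_eq_one_of_good_ordinary W p (by omega) hgood hord k)

/-- **The uniqueness half of Mazur–Stein–Tate 2006, Thm. 1.3 (= Mazur–Tate 1991, Thm. 3.1),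
proved.** For `E/ℚ` given by a globally minimal Weierstrass equation `W` and a prime `p ≥ 5` of good
ordinary reduction, there is AT MOST ONE pair `(σ, c)`, `σ = t + ⋯ ∈ tℤ_p⟦t⟧` odd, `c ∈ ℤ_p`, with
`x(t) + c = -(d/ω)(σ⁻¹ dσ/ω)`: two Mazur–Tate sigma pairs of `W ⊗ ℚ_p` coincide. (Existence — the
other half of "exactly one" — is Mazur–Tate 1991 §2 and is not proved in the tree.)
[Mazur–Stein–Tate 2006, Thm. 1.3; Mazur–Tate 1991, Thm. 3.1] [cite: MazurSteinTate2006, Thm. 1.3] -/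
theorem IsMazurTateSigmaPair.unique_of_good_ordinary (hp : 5 ≤ p)
    (hgood : W.HasGoodReductionAtPrime p) (hord : ¬ (p : ℤ) ∣ W.frobeniusTrace p)
    {σ₁ σ₂ : ℚ_[p]⟦X⟧} {c₁ c₂ : ℚ_[p]}
    (h₁ : (W.baseChange ℚ_[p]).IsMazurTateSigmaPair σ₁ c₁)
    (h₂ : (W.baseChange ℚ_[p]).IsMazurTateSigmaPair σ₂ c₂) : σ₁ = σ₂ ∧ c₁ = c₂ :=
  h₁.unique_of_unbounded_formalLog (unbounded_formalLog_of_good_ordinary W p hp hgood hord) h₂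

end Ordinary

/-- **`mazur_tate_sigma_existsUnique` (MST 2006 Thm. 1.3) reduced to its existence half.** If for
every globally minimal `W/ℚ` and every prime `p ≥ 5` of good ordinary reduction SOME Mazur–Tate
sigma pair of `W ⊗ ℚ_p` exists (Mazur–Tate 1991 §§2–3: the `p`-adic theta/sigma function of the
toroidal formal group; Blakestad–Grant 2023 Thm. 1), then the named fact holds — uniqueness and the
ordinarity input being the theorems of this file and of `PadicSigmaUniquenessProofs.lean`.
[Mazur–Stein–Tate 2006, Thm. 1.3; Mazur–Tate 1991, Thm. 3.1] [cite: MazurSteinTate2006, Thm. 1.3] -/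
theorem mazur_tate_sigma_existsUnique_of_exists
    (hex : ∀ (W : WeierstrassCurve ℚ) [W.IsElliptic] [W.IsGloballyMinimal] (p : ℕ) [Fact p.Prime],
      5 ≤ p → W.HasGoodReductionAtPrime p → ¬ (p : ℤ) ∣ W.frobeniusTrace p →
        ∃ σ : ℚ_[p]⟦X⟧, ∃ c, (W.baseChange ℚ_[p]).IsMazurTateSigmaPair σ c) :
    mazur_tate_sigma_existsUnique :=
  mazur_tate_sigma_existsUnique_of
    (fun W _ _ p _ hp hgood hord => unbounded_formalLog_of_good_ordinary W p hp hgood hord) hex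

end WeierstrassCurve
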